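import Summits.QuantumFields.YangMills.Theorems.PencilRigidityWeakCouplingHypercubicLimitStubRelativeBookkeeping
import HarnessLib

/-!
# Relative two-point bound from reflected spectral sums (line `Sketch` of crux
# `PencilRigidity.WeakCouplingHypercubicLimit`, stmt-QuantumFields-16120)

The normalisation step between the abstract reflected spectral sums (`reflectedSpectralSums`) and the real-analysis
bookkeeping `stub_relativeBookkeeping` (R2): given eigen-data `(bᵢ, λᵢ, i₀)` of a Hilbert basis with `0 ≤ λᵢ ≤ λ_{i₀}`,
`0 < λ_{i₀}`, a bond operator `B̂` with `‖B̂‖ ≤ B λ_{i₀}^{r+1}`, the spectral ratio `λᵢ ≤ e^{−g} λ_{i₀}` off the top, and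
the values of the vacuum, one-insertion and two reflected two-insertion spectral sums (`HasSum` hypotheses in the shapes
produced by `reflectedSpectralSums`), with all four normalised trace excesses `≤ X ∈ [0,1]`: the normalised two-point
quantity is bounded RELATIVE to its `n = 0` anchor,
`|Two_n/Vac − (One/Vac)²| ≤ e^{−g' n} (Two_0/Vac − (One/Vac)²) + 16 B² X` (`0 ≤ g' ≤ g`).
Proof: divide everything by `λ_{i₀}^N` (`N = 2r + n + b' + 5`), Parseval for the column sums
(`HilbertBasis.hasSum_inner_mul_inner`), and `stub_relativeBookkeeping`. [folklore]
-/

noncomputable section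

open scoped BigOperators Topology InnerProductSpace
open Filter

namespace Summit.QuantumFields.YangMills.Theorems.WeakCouplingHypercubicLimit.TraceNormColdPressure

/-- **Relative two-point bound from reflected spectral sums** (normalisation by `λ_{i₀}^N`, Parseval, and the
bookkeeping `stub_relativeBookkeeping`); see the module docstring. [folklore] -/
theorem relativeBound_of_reflectedSums :
    ∀ (E : Type) [NormedAddCommGroup E] [InnerProductSpace ℝ E] [CompleteSpace E] (ι : Type)
      (b : HilbertBasis ι ℝ E) (lam : ι → ℝ) (i₀ : ι) (Bop : E →L[ℝ] E) (B g g' X : ℝ) (rr n b' : ℕ)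
      (TwoN Two0 One Vac : ℝ),
      (∀ i, 0 ≤ lam i ∧ lam i ≤ lam i₀) → 0 < lam i₀ → ‖Bop‖ ≤ B * lam i₀ ^ (rr + 1) →
      (∀ i, i ≠ i₀ → lam i ≤ Real.exp (-g) * lam i₀) → 0 ≤ g' → g' ≤ g → 0 ≤ X → X ≤ 1 →
      HasSum (fun pr : ι × ι => lam pr.2 ^ (n + 1) * lam pr.1 ^ (b' + 2) * inner ℝ (b pr.2) (Bop (b pr.1)) ^ 2) TwoN →
      HasSum (fun pr : ι × ι => lam pr.2 ^ (0 + 1) * lam pr.1 ^ ((n + b') + 2) * inner ℝ (b pr.2) (Bop (b pr.1)) ^ 2) Two0 →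
      HasSum (fun i => lam i ^ (rr + n + b' + 2 + 2) * inner ℝ (b i) (Bop (b i))) One →
      HasSum (fun i => lam i ^ (2 * rr + n + b' + 3 + 2)) Vac →
      Summable (fun i => lam i ^ (b' + 2)) → Summable (fun i => lam i ^ ((n + b') + 2)) →
      Summable (fun i => lam i ^ (rr + n + b' + 2 + 2)) →
      (∑' i, lam i ^ (b' + 2)) / lam i₀ ^ (b' + 2) - 1 ≤ X →
      (∑' i, lam i ^ ((n + b') + 2)) / lam i₀ ^ ((n + b') + 2) - 1 ≤ X →
      (∑' i, lam i ^ (rr + n + b' + 2 + 2)) / lam i₀ ^ (rr + n + b' + 2 + 2) - 1 ≤ X →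
      (∑' i, lam i ^ (2 * rr + n + b' + 3 + 2)) / lam i₀ ^ (2 * rr + n + b' + 3 + 2) - 1 ≤ X →
      |TwoN / Vac - (One / Vac) ^ 2| ≤ Real.exp (-(g' * n)) * (Two0 / Vac - (One / Vac) ^ 2) + 16 * B ^ 2 * X := by
  intro E _ _ _ ι b lam i₀ Bop B g g' X rr n b' TwoN Two0 One Vac hlam hL0 hnB hratio hg'0 hg'g hX0 hX1
    hTwoN hTwo0 hOne hVac hsM hsM₀ hsp hXM hXM₀ hXp hXN
  classical
  -- notation
  set L : ℝ := lam i₀ with hL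
  have hL0' : L ≠ 0 := hL0.ne'
  have hLpow : ∀ k : ℕ, 0 < L ^ k := fun k => pow_pos hL0 k
  set N : ℕ := 2 * rr + n + b' + 3 + 2 with hNdef
  set M : ℕ := b' + 2 with hMdef
  set M₀ : ℕ := (n + b') + 2 with hM₀def
  set p : ℕ := rr + n + b' + 2 + 2 with hpdef
  set rat : ι → ℝ := fun i => lam i / L with hrat
  set dg : ι → ℝ := fun i => inner ℝ (b i) (Bop (b i)) / L ^ (rr + 1) with hdg
  set sqm : ι → ι → ℝ := fun j i => (inner ℝ (b j) (Bop (b i)) / L ^ (rr + 1)) ^ 2 with hsq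
  -- the hypotheses of the bookkeeping lemma
  have hrat01 : ∀ i, 0 ≤ rat i ∧ rat i ≤ 1 := fun i =>
    ⟨div_nonneg (hlam i).1 hL0.le, (div_le_one hL0).2 (hlam i).2⟩
  have hrat0 : rat i₀ = 1 := div_self hL0'
  have hratg : ∀ i, i ≠ i₀ → rat i ≤ Real.exp (-g) := fun i hi => by
    rw [hrat]; exact (div_le_iff₀ hL0).2 (hratio i hi)
  have hsq0 : ∀ j i, 0 ≤ sqm j i := fun j i => sq_nonneg _
  have hB0 : 0 ≤ B := by
    have h := (norm_nonneg Bop).trans hnB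
    exact nonneg_of_mul_nonneg_left h (hLpow _)
  have hBop : ‖Bop‖ / L ^ (rr + 1) ≤ B := (div_le_iff₀ (hLpow _)).2 hnB
  have hcol : ∀ i, Summable (fun j => sqm j i) ∧ ∑' j, sqm j i ≤ B ^ 2 := by
    intro i
    have hP := b.hasSum_inner_mul_inner (Bop (b i)) (Bop (b i))
    have hterm : ∀ j, inner ℝ (Bop (b i)) (b j) * inner ℝ (b j) (Bop (b i)) = inner ℝ (b j) (Bop (b i)) ^ 2 := fun j => by
      rw [real_inner_comm (Bop (b i)) (b j), pow_two]
    simp only [hterm, real_inner_self_eq_norm_sq] at hP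
    have hP' : HasSum (fun j => sqm j i) (‖Bop (b i)‖ ^ 2 / (L ^ (rr + 1)) ^ 2) := by
      have := hP.div_const ((L ^ (rr + 1)) ^ 2)
      refine this.congr_fun fun j => ?_
      rw [hsq]; dsimp only; rw [div_pow]
    refine ⟨hP'.summable, ?_⟩
    rw [hP'.tsum_eq, ← div_pow]
    have h1 : ‖Bop (b i)‖ / L ^ (rr + 1) ≤ B := by
      refine le_trans (div_le_div_of_nonneg_right ?_ (hLpow _).le) hBop
      have h := Bop.le_opNorm (b i)
      rwa [b.orthonormal.norm_eq_one i, mul_one] at h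
    have h0 : 0 ≤ ‖Bop (b i)‖ / L ^ (rr + 1) := div_nonneg (norm_nonneg _) (hLpow _).le
    exact pow_le_pow_left₀ h0 h1 2
  have hdgB : ∀ i, |dg i| ≤ B := by
    intro i
    rw [hdg]; dsimp only
    rw [abs_div, abs_of_pos (hLpow _)]
    refine le_trans (div_le_div_of_nonneg_right ?_ (hLpow _).le) hBop
    have h := Bop.le_opNorm (b i)
    rw [b.orthonormal.norm_eq_one i, mul_one] at h
    calc |inner ℝ (b i) (Bop (b i))| ≤ ‖b i‖ * ‖Bop (b i)‖ := abs_real_inner_le_norm _ _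
      _ ≤ ‖Bop‖ := by rw [b.orthonormal.norm_eq_one i, one_mul]; exact h
  have hdiag : dg i₀ ^ 2 = sqm i₀ i₀ := by rw [hdg, hsq]
  -- powers of the ratio: `rat i ^ m = lam i ^ m / L ^ m`
  have hratpow : ∀ (i : ι) (m : ℕ), rat i ^ m = lam i ^ m / L ^ m := fun i m => by rw [hrat]; dsimp only; rw [div_pow]
  have hsumm : ∀ m : ℕ, Summable (fun i => lam i ^ m) → Summable (fun i => rat i ^ m) := fun m h => by
    simp only [hratpow]; exact h.div_const _
  have htrace : ∀ m : ℕ, Summable (fun i => lam i ^ m) → (∑' i, lam i ^ m) / L ^ m - 1 ≤ X → (∑' i, rat i ^ m) - 1 ≤ X := by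
    intro m _ hXm
    simp only [hratpow]
    rwa [tsum_div_const]
  -- the normalised values
  have hVac' : HasSum (fun i => rat i ^ N) (Vac / L ^ N) := by
    simp only [hratpow]; exact hVac.div_const _
  have hOne' : HasSum (fun i => rat i ^ p * dg i) (One / L ^ N) := by
    have h := hOne.div_const (L ^ N)
    refine h.congr_fun fun i => ?_
    rw [hratpow, hdg]; dsimp only
    have hNp : N = p + (rr + 1) := by rw [hNdef, hpdef]; ring
    rw [hNp, pow_add]
    field_simp
    ring
  have hTwo' : ∀ (a c : ℕ) (T : ℝ), N = (a + 1) + c + 2 * (rr + 1) →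
      HasSum (fun pr : ι × ι => lam pr.2 ^ (a + 1) * lam pr.1 ^ c * inner ℝ (b pr.2) (Bop (b pr.1)) ^ 2) T →
      HasSum (fun pr : ι × ι => rat pr.2 ^ (a + 1) * rat pr.1 ^ c * sqm pr.2 pr.1) (T / L ^ N) := by
    intro a c T hNac hT
    have h := hT.div_const (L ^ N)
    refine h.congr_fun fun pr => ?_
    rw [hratpow, hratpow, hsq]; dsimp only
    rw [hNac]
    field_simp
    ring
  have hNn : N = (n + 1) + M + 2 * (rr + 1) := by rw [hNdef, hMdef]; ring
  have hN0 : N = (0 + 1) + M₀ + 2 * (rr + 1) := by rw [hNdef, hM₀def]; ring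
  have hTwoN' := hTwo' n M TwoN hNn hTwoN
  have hTwo0' := hTwo' 0 M₀ Two0 hN0 hTwo0
  -- the bookkeeping lemma
  have hsN : Summable (fun i => lam i ^ N) := hVac.summable
  have key := stub_relativeBookkeeping ι i₀ rat sqm dg B g g' X n M M₀ p N hrat01 hrat0 hg'0 hg'g hratg hsq0 hcol hdgB
    hdiag hX0 hX1 (hsumm M hsM) (hsumm M₀ hsM₀) (hsumm p hsp) (hsumm N hsN) (htrace M hsM hXM) (htrace M₀ hsM₀ hXM₀)
    (htrace p hsp hXp) (htrace N hsN hXN) hTwoN'.summable hTwo0'.summable hOne'.summable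
  rw [hTwoN'.tsum_eq, hTwo0'.tsum_eq, hOne'.tsum_eq, hVac'.tsum_eq] at key
  -- un-normalise
  have hLN := hLpow N
  have e1 : TwoN / L ^ N / (Vac / L ^ N) = TwoN / Vac := by field_simp
  have e2 : Two0 / L ^ N / (Vac / L ^ N) = Two0 / Vac := by field_simp
  have e3 : One / L ^ N / (Vac / L ^ N) = One / Vac := by field_simp
  rw [e1, e2, e3] at key
  exact key

end Summit.QuantumFields.YangMills.Theorems.WeakCouplingHypercubicLimit.TraceNormColdPressure

end
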